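import Summits.Ventures.WeilGRH.OddCharCountingLaw
import HarnessLib

/-!
# GRH arm (rh-explicit, venture WeilGRH): the counting law of every `χ`-rung measure, EITHER parity

Cell `rh-explicit`, WEIL TRACK (structure seat weil-3, gen8).  One-call wrappers dispatching on the parity:
gen6's even law (`WeilBochnerMeasureChar.abs_measureReal_Icc_sub_le_char`,
`…_symm_sub_le_char`) and gen8's odd law (`abs_measureReal_Icc_sub_le_char_odd`, `…_symm_…_odd`) give,
for EVERY Dirichlet character `χ` mod `q ≠ 1` and every positive measure `μ` representing `W_χ` on a window
`[-b, b]` (`b > 0`; such `μ` exist iff the rung `WeilPositivityOnChar χ b` holds):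

  `|μ[0,T] − θ(T)/π − (T/2π) log q|, |μ[−T,0] − θ(T)/π − (T/2π) log q| ≤ C(1 + log(1+T))`,
  `|μ[−T,T] − 2θ(T)/π − (T/π) log q| ≤ C(1 + log(1+T))`   (`T ≥ 0`)

— the Riemann–von Mangoldt counting function of `L(s, χ)`, `(T/π) log(qT/2πe) + O(log T)`, for every rung
of the GRH arm's positivity ladder.  No definitions, no named facts, RH/GRH-free.
-/

set_option autoImplicit false

noncomputable section

open Complex Filter Set MeasureTheory
open scoped Real Topology

namespace Summit.Ventures.WeilGRH

open Literature.NumberTheory.LFunctions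
open Summit.RiemannHypothesis.RiemannHypothesis.Theorems.WeilBochnerMeasureChar

variable {q : ℕ} {b : ℝ} {μ : Measure ℝ}

/-- **The counting law of a `χ`-rung measure, any parity, both half-lines**: for `χ` mod `q ≠ 1` and `μ`
representing `W_χ` on `[-b, b]` (`b > 0`) there is `C` with
`|μ[0,T] − θ(T)/π − (T/2π)log q| ≤ C(1 + log(1+T))` and `|μ[−T,0] − θ(T)/π − (T/2π)log q| ≤ C(1 + log(1+T))`
for all `T ≥ 0`. -/
theorem abs_measureReal_Icc_sub_le_char_any [NeZero q] (hq : q ≠ 1) (χ : DirichletCharacter ℂ q)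
    (hb : 0 < b)
    (hμ : ∀ g : ℝ → ℂ, IsWeilTest g → tsupport g ⊆ Icc (-b) b →
      Integrable (fun t : ℝ ↦ ‖weilMellin g (1 / 2 + t * I)‖ ^ 2) μ ∧
        weilQuadraticChar χ g = ((∫ t, ‖weilMellin g (1 / 2 + t * I)‖ ^ 2 ∂μ : ℝ) : ℂ)) :
    ∃ C : ℝ, ∀ T : ℝ, 0 ≤ T →
      |μ.real (Icc 0 T) - (riemannSiegelTheta T / π + T / (2 * π) * Real.log q)| ≤
          C * (1 + Real.log (1 + T)) ∧
        |μ.real (Icc (-T) 0) - (riemannSiegelTheta T / π + T / (2 * π) * Real.log q)| ≤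
          C * (1 + Real.log (1 + T)) := by
  rcases χ.even_or_odd with h | h
  · exact abs_measureReal_Icc_sub_le_char χ hq (charParity_of_even h) hb hμ
  · exact abs_measureReal_Icc_sub_le_char_odd hq (charParity_of_odd h) hb hμ

/-- **Symmetric form, any parity**: `|μ[−T,T] − 2θ(T)/π − (T/π) log q| ≤ C(1 + log(1+T))` — every
`χ`-rung measure (any `χ` mod `q ≠ 1`, any window) carries the density of zeros of `L(s, χ)`. -/
theorem abs_measureReal_Icc_symm_sub_le_char_any [NeZero q] (hq : q ≠ 1) (χ : DirichletCharacter ℂ q)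
    (hb : 0 < b)
    (hμ : ∀ g : ℝ → ℂ, IsWeilTest g → tsupport g ⊆ Icc (-b) b →
      Integrable (fun t : ℝ ↦ ‖weilMellin g (1 / 2 + t * I)‖ ^ 2) μ ∧
        weilQuadraticChar χ g = ((∫ t, ‖weilMellin g (1 / 2 + t * I)‖ ^ 2 ∂μ : ℝ) : ℂ)) :
    ∃ C : ℝ, ∀ T : ℝ, 0 ≤ T →
      |μ.real (Icc (-T) T) - (2 * riemannSiegelTheta T / π + T / π * Real.log q)| ≤
        C * (1 + Real.log (1 + T)) := by
  rcases χ.even_or_odd with h | h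
  · exact abs_measureReal_Icc_symm_sub_le_char χ hq (charParity_of_even h) hb hμ
  · exact abs_measureReal_Icc_symm_sub_le_char_odd hq (charParity_of_odd h) hb hμ

end Summit.Ventures.WeilGRH

end
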